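import Summits.QuantumFields.BalabanUV.Beta.MultiscaleGradientCommutator

/-!
# `Summit.QuantumFields.BalabanUV.Beta.MultiscaleGradientL2` — engine file 20c: the ℓ² GRADIENT MEMBER (3.46)₂'s SHAPE for `levelOp`,
# cell to cell, for EVERY isometric transport — `‖1_{b₋ ∈ cell k} D(levelOp)⁻¹u‖₂ ≤ √(2(C + d·e²c_max²))·(n_{k′}/μ₀)·e^{4dκ}·
# e^{−κ·d_n(t_k,t_{k′})}·‖u‖₂` for `u` supported in cell `k′` — GEOMETRY-FREE (no flatness, no (3.35)), from file 20a's conjugated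
# coercivity with the Dirichlet term and a bondwise commutator estimate

HONEST FRAMING (page 1 of everything in this cell).  Discharging `FlowStep.BetaPertH` would make Bałaban's ultraviolet
stability UNCONDITIONAL — a constructive-QFT result; it is NOT the continuum limit and NOT the Clay problem.  This module
discharges nothing of `BetaPertH`; it is [folklore] finite-dimensional bookkeeping about the MODEL operator, kernel-checked, by the
OWNER of binder row D4 (unit `b2b-balaban-beta-an4`, gen 46).  HONEST DEPENDENCY: continuum YM on T⁴ ⇐ BetaPertH ∧ nine spine
estimates (0/9 proved); BetaPertH ⇐ (D1) ∧ (D4) ∧ CAP+tail; G-an2-4 gates asym, D1 and NE2/3/4.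

THE POINT (O.2 item (i), MODEL level; NOT the critical path).  Census E-an4-141d split item (i) into the POINTWISE members, which
fail level-free for rough transports (the π-flux witness), and the ℓ² members (3.46)₂,₃ «‖h∇_UG′(U)λ‖, ‖hG′(U)∇*_Uλ‖ ≤ B₀L^jη|h|
e^{−δ₀d(y,y′)}‖λ‖», located as GEOMETRY-FREE.  THIS FILE proves the first of them for the MODEL operator `levelOp = D*D + Σ_l a_lG_lᵀG_l`
with ARBITRARY column-orthonormal bond matrices `Rm`: **`real_cellGrad_levelOp_inverse_le`** = file 20a's `hgrad_levelOp`
(Φ = (μ₀/C)·Σ(D·)², through 20b's `functional_le_of_pairing`) + `MultiscaleDecay.hc_levelOp` (the profile mass of `e^{κρ}w`, paying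
20b's commutator `bond_sum_commutator_le` with `θ_b = κ·slen ≤ κ/n(b₊)`, at most `d` bonds per target) + the cell floors∕ceilings of
`AccretiveCombesThomasSandwichSite.sdist_corner_thresholds`.  ONE power of the (source) scale — print's `L^jη` — with constants
`d, c_max, C, μ₀, κ` only; the target-scale form follows by the graded exchange of file 8 (not repeated).  WHAT THIS IS NOT: nothing
of Bałaban's ∇_UG′(U); (3.46) is a LOCATOR; row D4 readiness width 0; D4 DISCHARGE NO DATE.

WHAT IS CERTIFIED (kernel, 0 sorry, 0 def): **`real_cellGrad_levelOp_inverse_le`**, `real_cellGrad_levelOp_inverse_le_graded` (print's `h`-side scale under the additive grading; the binder-free ingredients —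
`functional_le_of_pairing`, the commutator `covD_expW`∕`sum_sq_exp_covD_le`∕`bond_sum_commutator_le` — are file 20b
`MultiscaleGradientCommutator`; the conjugated coercivity with the Dirichlet term is file 20a `MultiscaleGradientCoercive`).  LOCATORS (shape only; ABSOLUTE RULE — nothing printed is asserted):
[Balaban1985BackgroundPropagators] Thm 3.1 (3.46) p. 398, (3.3) pp. 390–391; [Balaban1984PropagatorsII] (2.46) p. 231.
NOT BetaPertH, NOT continuum, NOT Clay, NOT summit progress.
-/

open scoped BigOperators
open Finset

namespace Summit.QuantumFields.BalabanUV.Beta.MultiscaleGradientL2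

open Summit.QuantumFields.BalabanUV.Beta.BoxPoincare (Box)
open Summit.QuantumFields.BalabanUV.Beta.MultiscaleCoerciveTorus
open Summit.QuantumFields.BalabanUV.Beta.MultiscaleConjError (siteSq siteSq_nonneg)
open Summit.QuantumFields.BalabanUV.Beta.MultiscaleDistance
open Summit.QuantumFields.BalabanUV.Beta.MultiscaleDecayBudget
open Summit.QuantumFields.BalabanUV.Beta.MultiscaleDecay (hc_levelOp decay_levelOp)
open Summit.QuantumFields.BalabanUV.Beta.MultiscaleGradientCoercive (hgrad_levelOp)
open Summit.QuantumFields.BalabanUV.Beta.MultiscaleCombesThomasL2Real (real_weighted_solution_bound)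
open Summit.QuantumFields.BalabanUV.Beta.MultiscaleAveragingPointwise (isometry_sq_sum)
open Summit.QuantumFields.BalabanUV.Beta.AccretiveCombesThomasSandwichSite (sdist_corner_thresholds)
open Summit.QuantumFields.BalabanUV.Beta.MultiscaleDistanceGraded (scale_le_scale_mul_exp_add)
open Summit.QuantumFields.BalabanUV.Beta.MultiscaleCombesThomasL2CellsGraded (siteScale_ctrU)
open Literature.MathematicalPhysics.QuantumFieldTheory.Balaban1983to89
open Literature.MathematicalPhysics.QuantumFieldTheory.Balaban1983to89.B9Thm37Glue (covD covD_apply)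
open Literature.MathematicalPhysics.QuantumFieldTheory.Balaban1983to89.B9Thm37GluePU (bsrc btgt bsrc_apply btgt_apply)
open Literature.MathematicalPhysics.QuantumFieldTheory.Balaban1983to89.B9Thm37GlueTorusCov (tblk)
open Literature.MathematicalPhysics.QuantumFieldTheory.Balaban1983to89.B9Thm37GlueTorusCovLevels (levelOp)
open Literature.MathematicalPhysics.QuantumFieldTheory.Balaban1983to89.B9Thm37GlueTorusCovCT (expW expW_apply
  sum_comp_le_of_card_fiber_le card_filter_btgt_le)
open B5TorusCover (UT Ctr ctrU)

noncomputable section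

open Summit.QuantumFields.BalabanUV.Beta.MultiscaleGradientCommutator (functional_le_of_pairing bond_sum_commutator_le)

/-! ## THE ℓ² GRADIENT MEMBER (3.46)₂'s SHAPE FOR `levelOp`, CELL TO CELL, EVERY ISOMETRIC TRANSPORT -/

section Member

variable {d : ℕ} {N : Fin d → ℕ} [∀ i, NeZero (N i)] [NeZero d] {Cp J K : Type} [Fintype Cp] [DecidableEq Cp] [Nonempty Cp]
  [Fintype J] [Fintype K] [DecidableEq K] (S : J → ℕ) (hS : ∀ l, 1 ≤ S l) (hdivS : ∀ l i, S l ∣ N i) (lvl : K → J)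
  (zc : (k : K) → Ctr N (S (lvl k)))
  (hdisj : ∀ k k' v v', cellPt S hS hdivS lvl zc k v = cellPt S hS hdivS lvl zc k' v' → k = k')
  (hcover : ∀ x : UT N, ∃ k, ∃ v : Box d (S (lvl k)), cellPt S hS hdivS lvl zc k v = x)
  (Rm : UT N × Fin d → Cp → Cp → ℝ) (hRm : ∀ b i j, ∑ k, Rm b k i * Rm b k j = if i = j then (1 : ℝ) else 0)
  (T : J → UT N → Cp → Cp → ℝ) (hT : ∀ l x i i', ∑ k, T l x k i * T l x k i' = if i = i' then (1 : ℝ) else 0)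
  (a : J → ℝ) (ha : ∀ j, 0 ≤ a j) (ω : J → UT N → ℝ)
  (hsupp : ∀ l x, ω l (ctrU N (S l) (tblk (hS l) (hdivS l) x)) ≠ 0 → ∃ k v, lvl k = l ∧ cellPt S hS hdivS lvl zc k v = x)
  {amax : ℝ} (hamax : 0 ≤ amax)
  (hscale : ∀ k, a (lvl k) * ω (lvl k) (ctrU N (S (lvl k)) (zc k)) ^ 2 * (S (lvl k) : ℝ) ^ d ≤ amax / (S (lvl k) : ℝ) ^ 2)
  (c : UT N × Fin d → ℝ) {cmax : ℝ} (hc : ∀ b, |c b| ≤ cmax) {C : ℝ}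
  (hcoer : ∀ f : UT N × Cp → ℝ,
    C * ∑ k, ((S (lvl k) : ℝ) ^ 2)⁻¹ * ∑ v : Box d (S (lvl k)), ∑ i, f (cellPt S hS hdivS lvl zc k v, i) ^ 2 ≤
      ∑ p, f p * levelOp bsrc btgt c Rm (fun l x => ctrU N (S l) (tblk (hS l) (hdivS l) x))
        (fun l x => ω l (ctrU N (S l) (tblk (hS l) (hdivS l) x))) T a f p)
  {κ : ℝ} (hκ0 : 0 ≤ κ) (hκ1 : κ ≤ 1)

include hdisj hRm hT ha hsupp hamax hscale hc hcoer hκ0 hκ1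

/-- **THE ℓ² GRADIENT MEMBER (3.46)₂'s SHAPE FOR `levelOp` — EVERY ISOMETRIC TRANSPORT, LEVEL-FREE.**  In the MODEL setting of
`MultiscaleDecay.hc_levelOp` (isometric `Rm`, `T`; (P) budget; `|c| ≤ c_max`; cell-sum coercivity `C`; `0 ≤ κ ≤ 1`; margin
`μ₀ = C − 2d·c_max²κ² − a_max(e^{2dκ} − 1) > 0`), for `u` supported in cell `k′` and every cell `k`:
`√(Σ_{b : b₋ ∈ cell k} Σ_i ((D (levelOp)⁻¹u)(b,i))²) ≤ √(2(C + d·e²·c_max²))·(n_{k′}/μ₀)·e^{4dκ}·e^{−κ·d_n(t_k, t_{k′})}·√(Σ_{cell k′} u²)`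
— ONE power of the source scale (print's `L^jη`), NO flatness, NO small-field condition: file 20a's `hgrad_levelOp` and `hc_levelOp`
through 20b's `functional_le_of_pairing` at `Φ = (μ₀/C)Σ(D·)²`, 20b's `bond_sum_commutator_le` with `φ = κ·d_n(·, t_{k′})`, the source-cell ceiling `d_n ≤ 2d` and the target-cell floor
`d_n ≥ d_n(t_k,t_{k′}) − 2d` of `sdist_corner_thresholds`.
[cite: Balaban1985BackgroundPropagators, Thm 3.1 (3.46) p.398; Balaban1984PropagatorsII, (2.46) p.231] [folklore] -/
theorem real_cellGrad_levelOp_inverse_le (hμ : 0 < C - 2 * d * cmax ^ 2 * κ ^ 2 - amax * (Real.exp (2 * d * κ) - 1))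
    (k' : K) (u : UT N × Cp → ℝ) (hu : ∀ p, cellOf S hS hdivS lvl zc hcover p.1 ≠ k' → u p = 0) (k : K) :
    Real.sqrt (∑ b ∈ univ.filter (fun b : UT N × Fin d => cellOf S hS hdivS lvl zc hcover (bsrc b) = k),
        ∑ i, (covD bsrc btgt c Rm ((Ring.inverse (levelOp bsrc btgt c Rm (fun l x => ctrU N (S l) (tblk (hS l) (hdivS l) x))
          (fun l x => ω l (ctrU N (S l) (tblk (hS l) (hdivS l) x))) T a)) u) (b, i)) ^ 2) ≤
      Real.sqrt (2 * (C + d * Real.exp 1 ^ 2 * cmax ^ 2)) *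
        ((S (lvl k') : ℝ) / (C - 2 * d * cmax ^ 2 * κ ^ 2 - amax * (Real.exp (2 * d * κ) - 1))) *
        Real.exp (4 * d * κ) *
        Real.exp (-(κ * sdist bsrc btgt (siteScale S hS hdivS lvl zc hcover)
          (ctrU N (S (lvl k)) (zc k)) (ctrU N (S (lvl k')) (zc k')))) *
        Real.sqrt (∑ q ∈ univ.filter (fun q : UT N × Cp => cellOf S hS hdivS lvl zc hcover q.1 = k'), u q ^ 2) := by
  classical
  obtain ⟨i₀⟩ := ‹Nonempty Cp›
  set μ₀ := C - 2 * d * cmax ^ 2 * κ ^ 2 - amax * (Real.exp (2 * d * κ) - 1) with hμ₀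
  set Aop := levelOp bsrc btgt c Rm (fun l x => ctrU N (S l) (tblk (hS l) (hdivS l) x))
    (fun l x => ω l (ctrU N (S l) (tblk (hS l) (hdivS l) x))) T a with hAop
  set n := siteScale S hS hdivS lvl zc hcover with hn
  set tk : UT N := ctrU N (S (lvl k)) (zc k) with htk
  set tk' : UT N := ctrU N (S (lvl k')) (zc k') with htk'
  set w := (Ring.inverse Aop) u with hw
  set ρ : UT N × Cp → ℝ := fun p => sdist bsrc btgt n p.1 tk' with hρ
  set φ : UT N → ℝ := fun x => κ * sdist bsrc btgt n x tk' with hφ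
  set Bd := univ.filter (fun b : UT N × Fin d => cellOf S hS hdivS lvl zc hcover (bsrc b) = k) with hBd
  set Src := univ.filter (fun q : UT N × Cp => cellOf S hS hdivS lvl zc hcover q.1 = k') with hSrc
  set D0 : ℝ := sdist bsrc btgt n tk tk' with hD0
  set n' : ℝ := (S (lvl k') : ℝ) with hn'
  set Ke : ℝ := 2 * (C + d * Real.exp 1 ^ 2 * cmax ^ 2) with hKe
  -- positivity and units
  have hd0 : (0 : ℝ) < d := by exact_mod_cast Nat.pos_of_ne_zero (NeZero.ne d)
  have hn0 : ∀ x, (0 : ℝ) < (n x : ℝ) := fun x => by exact_mod_cast one_le_siteScale S hS hdivS lvl zc hcover x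
  have hn'0 : 0 < n' := by rw [hn']; exact_mod_cast hS (lvl k')
  have hC : 0 < C := by
    have h1 : 0 ≤ 2 * (d : ℝ) * cmax ^ 2 * κ ^ 2 := by positivity
    have h2 : 0 ≤ amax * (Real.exp (2 * d * κ) - 1) := by
      refine mul_nonneg hamax ?_
      have : 0 ≤ 2 * (d : ℝ) * κ := by positivity
      linarith [Real.one_le_exp_iff.mpr this]
    linarith
  have hKe0 : 0 ≤ Ke := by rw [hKe]; positivity
  have hunit : IsUnit Aop :=
    (decay_levelOp S hS hdivS lvl zc hdisj hcover Rm hRm T hT a ha ω hsupp hamax hscale c hc hcoer hκ0 hκ1 hμ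
      (tk', i₀) (tk', i₀)).1
  have hAw : Aop w = u := by
    rw [hw, ← Module.End.mul_apply, Ring.mul_inverse_cancel _ hunit, Module.End.one_apply]
  -- `g = e^{κρ}w = expW φ w`
  have hg : (fun p : UT N × Cp => Real.exp (κ * ρ p) * w p) = expW φ w := by
    funext p; rw [hφ, hρ]; rfl
  -- the profile hypothesis (hc_levelOp) and the gradient hypothesis (hgrad_levelOp), in §1's letters
  set μ : UT N × Cp → ℝ := fun p => μ₀ * ((n p.1 : ℝ) ^ 2)⁻¹ with hμdef
  have hμpos : ∀ p, 0 < μ p := fun p => mul_pos hμ (inv_pos.mpr (pow_pos (hn0 p.1) 2))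
  have hcH : ∀ v : UT N × Cp → ℝ, ∑ p, μ p * v p ^ 2 ≤
      ∑ p, Real.exp (κ * ρ p) * v p * Aop (fun q => Real.exp (-(κ * ρ q)) * v q) p := fun v =>
    hc_levelOp S hS hdivS lvl zc hdisj hcover Rm hRm T hT a ha ω hsupp hamax hscale c hc hcoer hκ0 hκ1 (tk', i₀) v
  have hΦle : ∀ v : UT N × Cp → ℝ, μ₀ / C * ∑ q, (covD bsrc btgt c Rm v q) ^ 2 ≤
      ∑ p, Real.exp (κ * ρ p) * v p * Aop (fun q => Real.exp (-(κ * ρ q)) * v q) p := by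
    intro v
    have h := hgrad_levelOp S hS hdivS lvl zc hdisj hcover Rm hRm T hT a ha ω hsupp hamax hscale c hc hcoer hκ0 hκ1 hμ (tk', i₀) v
    rw [← hμ₀, ← hAop] at h
    rw [div_mul_eq_mul_div, div_le_iff₀ hC]
    linarith
  -- (20b §1) the Dirichlet energy and the profile mass of `g` are below `Qu`
  set Qu : ℝ := ∑ p, (μ p)⁻¹ * (Real.exp (κ * ρ p) * u p) ^ 2 with hQu
  have hDg : μ₀ / C * ∑ q, (covD bsrc btgt c Rm (expW φ w) q) ^ 2 ≤ Qu := by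
    have h := functional_le_of_pairing hμpos hcH (fun v => μ₀ / C * ∑ q, (covD bsrc btgt c Rm v q) ^ 2) hΦle hAw
    rw [hg] at h
    exact h
  have hPg : ∑ p, μ p * (expW φ w) p ^ 2 ≤ Qu := by
    have h := real_weighted_solution_bound hμpos hcH hAw
    refine le_of_eq_of_le (Finset.sum_congr rfl fun p _ => ?_) h
    rw [← hg]
  -- `Qu ≤ (n′²/μ₀)·e^{4dκ}·Σ_{Src} u²`
  have hthr := sdist_corner_thresholds S hS hdivS lvl zc hdisj hcover
  set U2 : ℝ := ∑ q ∈ Src, u q ^ 2 with hU2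
  have hU20 : 0 ≤ U2 := Finset.sum_nonneg fun q _ => sq_nonneg _
  have hQu_le : Qu ≤ n' ^ 2 / μ₀ * Real.exp (4 * d * κ) * U2 := by
    have hsplit : Qu = ∑ p ∈ Src, (μ p)⁻¹ * (Real.exp (κ * ρ p) * u p) ^ 2 := by
      rw [hQu]
      symm
      refine Finset.sum_subset (Finset.subset_univ Src) fun p _ hp => ?_
      have : u p = 0 := hu p (fun h => hp (by rw [hSrc, mem_filter]; exact ⟨mem_univ _, h⟩))
      rw [this]; simp
    rw [hsplit, hU2, Finset.mul_sum]
    refine Finset.sum_le_sum fun p hp => ?_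
    have hpk : cellOf S hS hdivS lvl zc hcover p.1 = k' := (mem_filter.mp hp).2
    have hnp : (n p.1 : ℝ) = n' := by rw [hn, hn', siteScale, hpk]
    have hρp : ρ p ≤ 2 * d := by rw [hρ]; exact (hthr p.1 k').1 hpk
    have hκρ : κ * ρ p ≤ κ * (2 * d) := mul_le_mul_of_nonneg_left hρp hκ0
    have hexp : Real.exp (κ * ρ p) ^ 2 ≤ Real.exp (4 * d * κ) := by
      rw [sq, ← Real.exp_add]
      exact Real.exp_le_exp.mpr (by linarith)
    have hμinv : (μ p)⁻¹ = n' ^ 2 / μ₀ := by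
      rw [hμdef]; simp only; rw [hnp, mul_inv, inv_inv, div_eq_mul_inv, mul_comm]
    rw [hμinv, mul_pow]
    have : n' ^ 2 / μ₀ * (Real.exp (κ * ρ p) ^ 2 * u p ^ 2) ≤ n' ^ 2 / μ₀ * (Real.exp (4 * d * κ) * u p ^ 2) :=
      mul_le_mul_of_nonneg_left (mul_le_mul_of_nonneg_right hexp (sq_nonneg _)) (by positivity)
    linarith
  -- (20b §3) the commutator summed over `Bd`
  have hφb : ∀ b : UT N × Fin d, |φ (btgt b) - φ (bsrc b)| ≤ κ * slen n (bsrc b) (btgt b) := by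
    intro b
    rw [hφ]; simp only
    rw [← mul_sub, abs_mul, abs_of_nonneg hκ0]
    exact mul_le_mul_of_nonneg_left (abs_sdist_tgt_sub_src_le bsrc btgt n b tk') hκ0
  have hsum := bond_sum_commutator_le S hS hdivS lvl zc hcover Rm hRm c hc hκ0 hκ1 φ hφb w Bd
  -- the profile mass `Σ_x n(x)⁻²‖g(x)‖² = (Σ_p μ_p g_p²)/μ₀ ≤ Qu/μ₀`
  have hmass : ∑ x, ((n x : ℝ) ^ 2)⁻¹ * siteSq (expW φ w) x ≤ Qu / μ₀ := by
    rw [le_div_iff₀ hμ]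
    have e : (∑ x, ((n x : ℝ) ^ 2)⁻¹ * siteSq (expW φ w) x) * μ₀ = ∑ p, μ p * (expW φ w) p ^ 2 := by
      rw [Fintype.sum_prod_type, Finset.sum_mul]
      refine Finset.sum_congr rfl fun x _ => ?_
      unfold siteSq
      rw [Finset.mul_sum, Finset.sum_mul]
      refine Finset.sum_congr rfl fun i _ => ?_
      rw [hμdef]
      ring
    rw [e]
    exact hPg
  have hDg' : ∑ q, (covD bsrc btgt c Rm (expW φ w) q) ^ 2 ≤ C / μ₀ * Qu := by
    have h := hDg
    rw [div_mul_eq_mul_div, div_le_iff₀ hC] at h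
    rw [div_mul_eq_mul_div, le_div_iff₀ hμ]
    linarith
  -- the target floor `φ(b₋) ≥ κ(D0 − 2d)` on `Bd`
  have hfloor : ∀ b ∈ Bd, κ * (D0 - 2 * d) ≤ φ (bsrc b) := by
    intro b hb
    have hbk : cellOf S hS hdivS lvl zc hcover (bsrc b) = k := (mem_filter.mp hb).2
    have h2 := (hthr (bsrc b) k').2
    rw [hbk] at h2
    rw [hφ]; simp only
    exact mul_le_mul_of_nonneg_left (by rw [hD0, htk]; linarith) hκ0
  set LHS2 : ℝ := ∑ b ∈ Bd, ∑ i, (covD bsrc btgt c Rm w (b, i)) ^ 2 with hLHS2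
  have hLHS0 : 0 ≤ LHS2 := Finset.sum_nonneg fun b _ => Finset.sum_nonneg fun i _ => sq_nonneg _
  have hL : Real.exp (2 * (κ * (D0 - 2 * d))) * LHS2 ≤
      ∑ b ∈ Bd, ∑ i, (Real.exp (φ (bsrc b)) * covD bsrc btgt c Rm w (b, i)) ^ 2 := by
    rw [hLHS2, Finset.mul_sum]
    refine Finset.sum_le_sum fun b hb => ?_
    rw [Finset.mul_sum]
    refine Finset.sum_le_sum fun i _ => ?_
    rw [mul_pow, sq (Real.exp _), ← Real.exp_add]
    have : Real.exp (2 * (κ * (D0 - 2 * d))) ≤ Real.exp (φ (bsrc b) + φ (bsrc b)) :=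
      Real.exp_le_exp.mpr (by linarith [hfloor b hb])
    exact mul_le_mul_of_nonneg_right this (sq_nonneg _)
  -- assemble the square bound: `e^{2κ(D0−2d)}·LHS2 ≤ (Ke/μ₀)·Qu ≤ (Ke/μ₀)(n′²/μ₀)e^{4dκ}U2`
  have hQ0 : 0 ≤ Qu := le_trans (Finset.sum_nonneg fun p _ => mul_nonneg (hμpos p).le (sq_nonneg _)) hPg
  have hκ2 : κ ^ 2 ≤ 1 := by
    have := mul_le_mul hκ1 hκ1 hκ0 zero_le_one
    nlinarith
  have hsq : Real.exp (2 * (κ * (D0 - 2 * d))) * LHS2 ≤ Ke / μ₀ * (n' ^ 2 / μ₀ * Real.exp (4 * d * κ) * U2) := by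
    have h1 : 2 * ∑ q, (covD bsrc btgt c Rm (expW φ w) q) ^ 2 ≤ 2 * (C / μ₀ * Qu) := by linarith
    have hA : d * ∑ x, ((n x : ℝ) ^ 2)⁻¹ * siteSq (expW φ w) x ≤ d * (Qu / μ₀) := mul_le_mul_of_nonneg_left hmass hd0.le
    have hB : cmax ^ 2 * Real.exp 1 ^ 2 * κ ^ 2 ≤ cmax ^ 2 * Real.exp 1 ^ 2 * 1 :=
      mul_le_mul_of_nonneg_left hκ2 (by positivity)
    have hmassnn : 0 ≤ d * ∑ x, ((n x : ℝ) ^ 2)⁻¹ * siteSq (expW φ w) x :=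
      mul_nonneg hd0.le (Finset.sum_nonneg fun x _ => mul_nonneg (inv_nonneg.mpr (sq_nonneg _)) (siteSq_nonneg _ x))
    have h2 : cmax ^ 2 * Real.exp 1 ^ 2 * κ ^ 2 * (d * ∑ x, ((n x : ℝ) ^ 2)⁻¹ * siteSq (expW φ w) x) ≤
        cmax ^ 2 * Real.exp 1 ^ 2 * 1 * (d * (Qu / μ₀)) :=
      mul_le_mul hB hA hmassnn (by positivity)
    have h3 : 2 * (C / μ₀ * Qu) + 2 * (cmax ^ 2 * Real.exp 1 ^ 2 * 1 * (d * (Qu / μ₀))) = Ke / μ₀ * Qu := by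
      rw [hKe]
      field_simp
    have h4 : Ke / μ₀ * Qu ≤ Ke / μ₀ * (n' ^ 2 / μ₀ * Real.exp (4 * d * κ) * U2) :=
      mul_le_mul_of_nonneg_left hQu_le (div_nonneg hKe0 hμ.le)
    linarith [hL, hsum, h1, h2, h3, h4]
  -- divide by the floor and take square roots
  have hE0 : 0 < Real.exp (2 * (κ * (D0 - 2 * d))) := Real.exp_pos _
  set Kf : ℝ := Real.sqrt Ke * (n' / μ₀) * Real.exp (4 * d * κ) * Real.exp (-(κ * D0)) with hKf
  have hKf0 : 0 ≤ Kf := by rw [hKf]; positivity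
  have hKf2 : Kf ^ 2 * Real.exp (2 * (κ * (D0 - 2 * d))) = Ke / μ₀ * (n' ^ 2 / μ₀ * Real.exp (4 * d * κ)) := by
    have e2 : (Real.sqrt Ke) ^ 2 = Ke := Real.sq_sqrt hKe0
    have e3 : (Real.exp (4 * d * κ) * Real.exp (-(κ * D0))) ^ 2 * Real.exp (2 * (κ * (D0 - 2 * d))) =
        Real.exp (4 * d * κ) := by
      rw [sq, ← Real.exp_add, ← Real.exp_add, ← Real.exp_add]
      congr 1
      ring
    have hμne : μ₀ ≠ 0 := hμ.ne'
    calc Kf ^ 2 * Real.exp (2 * (κ * (D0 - 2 * d)))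
        = (Real.sqrt Ke) ^ 2 * (n' / μ₀) ^ 2 *
            ((Real.exp (4 * d * κ) * Real.exp (-(κ * D0))) ^ 2 * Real.exp (2 * (κ * (D0 - 2 * d)))) := by
          rw [hKf]; ring
      _ = Ke * (n' / μ₀) ^ 2 * Real.exp (4 * d * κ) := by rw [e2, e3]
      _ = Ke / μ₀ * (n' ^ 2 / μ₀ * Real.exp (4 * d * κ)) := by field_simp
  have hsq' : LHS2 ≤ Kf ^ 2 * U2 := by
    -- multiply the target inequality by the positive floor
    have h : Real.exp (2 * (κ * (D0 - 2 * d))) * LHS2 ≤ Real.exp (2 * (κ * (D0 - 2 * d))) * (Kf ^ 2 * U2) := by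
      calc Real.exp (2 * (κ * (D0 - 2 * d))) * LHS2 ≤ Ke / μ₀ * (n' ^ 2 / μ₀ * Real.exp (4 * d * κ) * U2) := hsq
        _ = Kf ^ 2 * Real.exp (2 * (κ * (D0 - 2 * d))) * U2 := by rw [hKf2]; ring
        _ = Real.exp (2 * (κ * (D0 - 2 * d))) * (Kf ^ 2 * U2) := by ring
    exact le_of_mul_le_mul_left h hE0
  calc Real.sqrt LHS2 ≤ Real.sqrt (Kf ^ 2 * U2) := Real.sqrt_le_sqrt hsq'
    _ = Kf * Real.sqrt U2 := by rw [Real.sqrt_mul (sq_nonneg _), Real.sqrt_sq hKf0]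
    _ = Real.sqrt Ke * (n' / μ₀) * Real.exp (4 * d * κ) * Real.exp (-(κ * D0)) * Real.sqrt U2 := by rw [hKf]

/-- **THE ℓ² GRADIENT MEMBER IN PRINT'S CONVENTION (the `h`-side scale), UNDER THE ADDITIVE GRADING.**  With graded sides
`S_l = L^{e_l}` (`1 ≤ L`) and the sitewise additive datum `|e(x) − e(y)| ≤ A + d_n(x,y)/R`, the source scale of
`real_cellGrad_levelOp_inverse_le` is exchanged for the scale of the evaluation cell `k` (print's `L^jη`, `y ∈ Λ_j` the `h`-side) at
the usual rate loss: `… ≤ √(2(C + d·e²·c_max²))·L^A·(n_k/μ₀)·e^{4dκ}·e^{−(κ − log L/R)·d_n(t_k,t_{k′})}·‖u‖₂`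
(`scale_le_scale_mul_exp_add` at `(t_k, t_{k′})`). [cite: Balaban1985BackgroundPropagators, Thm 3.1 (3.46) p.398 + p.398 «(L^jη)^α by (L^jη)^β(L^{j′}η)^γ»] [folklore] -/
theorem real_cellGrad_levelOp_inverse_le_graded (hμ : 0 < C - 2 * d * cmax ^ 2 * κ ^ 2 - amax * (Real.exp (2 * d * κ) - 1))
    {L : ℕ} (hL : 1 ≤ L) (e : J → ℕ) (hSe : ∀ l, S l = L ^ e l) {R : ℝ} {A : ℕ}
    (hadd : ∀ x y : UT N, |(e (lvl (cellOf S hS hdivS lvl zc hcover x)) : ℝ) - e (lvl (cellOf S hS hdivS lvl zc hcover y))| ≤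
      A + sdist bsrc btgt (siteScale S hS hdivS lvl zc hcover) x y / R)
    (k' : K) (u : UT N × Cp → ℝ) (hu : ∀ p, cellOf S hS hdivS lvl zc hcover p.1 ≠ k' → u p = 0) (k : K) :
    Real.sqrt (∑ b ∈ univ.filter (fun b : UT N × Fin d => cellOf S hS hdivS lvl zc hcover (bsrc b) = k),
        ∑ i, (covD bsrc btgt c Rm ((Ring.inverse (levelOp bsrc btgt c Rm (fun l x => ctrU N (S l) (tblk (hS l) (hdivS l) x))
          (fun l x => ω l (ctrU N (S l) (tblk (hS l) (hdivS l) x))) T a)) u) (b, i)) ^ 2) ≤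
      Real.sqrt (2 * (C + d * Real.exp 1 ^ 2 * cmax ^ 2)) * (L : ℝ) ^ A *
        ((S (lvl k) : ℝ) / (C - 2 * d * cmax ^ 2 * κ ^ 2 - amax * (Real.exp (2 * d * κ) - 1))) *
        Real.exp (4 * d * κ) *
        Real.exp (-((κ - Real.log L / R) * sdist bsrc btgt (siteScale S hS hdivS lvl zc hcover)
          (ctrU N (S (lvl k)) (zc k)) (ctrU N (S (lvl k')) (zc k')))) *
        Real.sqrt (∑ q ∈ univ.filter (fun q : UT N × Cp => cellOf S hS hdivS lvl zc hcover q.1 = k'), u q ^ 2) := by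
  set n := siteScale S hS hdivS lvl zc hcover with hn
  set μ₀ := C - 2 * d * cmax ^ 2 * κ ^ 2 - amax * (Real.exp (2 * d * κ) - 1) with hμ₀
  set tk : UT N := ctrU N (S (lvl k)) (zc k) with htk
  set tk' : UT N := ctrU N (S (lvl k')) (zc k') with htk'
  set D0 : ℝ := sdist bsrc btgt n tk tk' with hD0
  have h := real_cellGrad_levelOp_inverse_le S hS hdivS lvl zc hdisj hcover Rm hRm T hT a ha ω hsupp hamax hscale c hc hcoer hκ0 hκ1
    hμ k' u hu k
  rw [← hμ₀, ← hn] at h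
  -- the graded exchange of the source scale for the target scale
  have hgr : ∀ y, n y = L ^ (e (lvl (cellOf S hS hdivS lvl zc hcover y))) := fun y => by rw [hn, siteScale, hSe]
  have hex : (n tk' : ℝ) ≤ (L : ℝ) ^ A * n tk * Real.exp (Real.log L / R * D0) :=
    scale_le_scale_mul_exp_add bsrc btgt n hL (fun y => e (lvl (cellOf S hS hdivS lvl zc hcover y))) hgr (A := A) (hadd tk tk')
  have hntk : (n tk : ℝ) = S (lvl k) := by rw [hn, htk, siteScale_ctrU S hS hdivS lvl zc hdisj hcover k]
  have hntk' : (n tk' : ℝ) = S (lvl k') := by rw [hn, htk', siteScale_ctrU S hS hdivS lvl zc hdisj hcover k']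
  rw [hntk, hntk'] at hex
  -- compare the two prefactors
  have hKe0 : 0 ≤ Real.sqrt (2 * (C + d * Real.exp 1 ^ 2 * cmax ^ 2)) := Real.sqrt_nonneg _
  have hU0 : 0 ≤ Real.sqrt (∑ q ∈ univ.filter (fun q : UT N × Cp => cellOf S hS hdivS lvl zc hcover q.1 = k'), u q ^ 2) :=
    Real.sqrt_nonneg _
  have hfac : (S (lvl k') : ℝ) / μ₀ * Real.exp (4 * d * κ) * Real.exp (-(κ * D0)) ≤
      (L : ℝ) ^ A * ((S (lvl k) : ℝ) / μ₀) * Real.exp (4 * d * κ) * Real.exp (-((κ - Real.log L / R) * D0)) := by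
    have e1 : (L : ℝ) ^ A * ((S (lvl k) : ℝ) / μ₀) * Real.exp (4 * d * κ) * Real.exp (-((κ - Real.log L / R) * D0)) =
        ((L : ℝ) ^ A * S (lvl k) * Real.exp (Real.log L / R * D0)) / μ₀ * Real.exp (4 * d * κ) * Real.exp (-(κ * D0)) := by
      rw [show -((κ - Real.log L / R) * D0) = Real.log L / R * D0 + -(κ * D0) by ring, Real.exp_add]
      ring
    rw [e1]
    have : (S (lvl k') : ℝ) / μ₀ ≤ ((L : ℝ) ^ A * S (lvl k) * Real.exp (Real.log L / R * D0)) / μ₀ :=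
      div_le_div_of_nonneg_right hex hμ.le
    exact mul_le_mul_of_nonneg_right (mul_le_mul_of_nonneg_right this (Real.exp_pos _).le) (Real.exp_pos _).le
  calc _ ≤ _ := h
    _ ≤ Real.sqrt (2 * (C + d * Real.exp 1 ^ 2 * cmax ^ 2)) *
          ((L : ℝ) ^ A * ((S (lvl k) : ℝ) / μ₀) * Real.exp (4 * d * κ) * Real.exp (-((κ - Real.log L / R) * D0))) *
          Real.sqrt (∑ q ∈ univ.filter (fun q : UT N × Cp => cellOf S hS hdivS lvl zc hcover q.1 = k'), u q ^ 2) := by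
        have := mul_le_mul_of_nonneg_left hfac hKe0
        have := mul_le_mul_of_nonneg_right this hU0
        refine le_trans (le_of_eq ?_) (this.trans (le_of_eq ?_)) <;> ring
    _ = _ := by ring

end Member

end

end Summit.QuantumFields.BalabanUV.Beta.MultiscaleGradientL2
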